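import Summits.QuantumFields.YangMills.Theorems.UnitScaleTiltProp7SectET3N06LeavesRecordCut
import Summits.QuantumFields.YangMills.Theorems.UnitScaleTiltProp7SectET3G0LayerFromThm310E
import Summits.QuantumFields.YangMills.Theorems.UnitScaleTiltProp7SectET3StepDirLayerFromLetters
import Summits.QuantumFields.YangMills.Theorems.UnitScaleTiltProp7SectET3KernelFamilyCanonical
import Summits.QuantumFields.YangMills.Theorems.UnitScaleTiltProp7SectET3OpsSymmetry
import Summits.QuantumFields.YangMills.Theorems.UnitScaleTiltProp7SectET3ClassTransferRows
import HarnessLib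

/-!
# Route `UnitScaleTilt` (α), node N06(d = 3) — **THE `norm_G` ROW OF C-min WITH ALL THREE BOOKKEEPING REDUCTIONS, RE-CUT TO PRINT'S LETTER SPECIES**: the weaker-hypothesis twin of
# ym-inputs-p03 g2's ✓ p625281 `Prop7SectET3N06LeavesRecordStepLayerEvalRowsS.normG_row_of_letterLayers_evaluationRowsS` over the re-cut T³ leaf
# `Prop7SectET3N06LeavesRecordCut.t313_of_pins_T3_completePairMBZc` — the displayed letter rows `hletters`∕`hLL2` no longer carry the three beyond-print fields
# `Letters313Z.rgd1 ∕ gD1`, `Letters313L2PZ.ddGDv ∕ rgdDds` (★★OWNER RULING g26-№21 (5) hazard «N06-LETTERS-SPECIES», WANTED №g26-7)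

Cell `ym-inputs` (D-0154 (2); desk `ym-inputs-plan-1` gen 10 WORD 2026-08-28T11:37:45Z «S1–S3 → ym-inputs-p04 g2»), seat ym-inputs-p04 gen 2.  Count-neutral helper
(`--supports stmt-QuantumFields-20520 --as helper`; RULING g26-№2 «B0 of (O″χ) needs N06(d = 3)»); registry untouched; THEOREMS ONLY (0 `def`, 0 `sorry`); NOTHING of
[Balaban1985BackgroundPropagators] is asserted.

WHAT.  ★★★ `normG_row_of_letterLayers_evaluationRowsSc` is ✓`normG_row_of_letterLayers_evaluationRowsS` (its header announced: «a weaker-hypothesis twin waits on the Literature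
re-thread L0–L7») with EXACTLY these changes — everything else (Theorem 3.10's schemas at `𝔬A`, the (3.131)∕(3.137)∕(3.126)∕(3.132) letters at `𝔬12`, the TEN evaluation rows, `hls`,
`hread`, `hCTS`, the numerics, both layer derivations `g0_layer_T3_of_thm310_coreB` ∕ `stepDirB_layer_T3_of_lettersCZ`, the canonical kernel family, the (3.47) pin, the proof) VERBATIM:
* new data `(Gp : ∀ x, Cfg → End (W x → ℝ))` (the site propagator G′ of (3.152)), `(bXH : ∀ x, BlockNorm … (X x → ℝ))` (the free sup ⊕ Hölder class of G₁∇\*_U) with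
  `hκX : ∀ x, (bXH x).κ ≤ κ₀`; the printed identity row `h152 : … Ids3152 (𝔬12 x) (Gp x) U` ((3.152), displayed BY NAME, nothing asserted);
* `hletters` = the INLINE ∀-row valued in `Letters313Zc (𝔬12 x) (Gp x) 1 (H x) (geoOK_geo9K x) (wZ x) (hwZ x) B12₃ δ12₃ (bXH x) U` (def-free; `−rgd1 −gD1 +gXH +wGp`; its KEPT
  field `.gD2` still feeds the face-E G₀ layer); `hLL2` valued in `Letters313L2Pc … ∧ Letters313L2MZ …` (`−ddGDv −rgdDds +vDRDG +vGDRD`);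
* `hLH3 : … Letters313HZ …` STAYS (LOCATED 2026-08-28T11:50Z: the StepDir layer's engine `B9Thm312WholeDirBC.stepDirB_of_letters3131LRCZ` READS `hLH3.pXDv β`, the field the
  Literature cut record `Letters313HZc` dropped as unread by the Thm-3.13 chain) and ONE new displayed row `hWE` (Φ^X_β∘(D·G′·R·D\*) : `bXH` → 𝔠_P^{(β−1)}, `Bx13 β·e^{−δ12₃d}`;
  print's (3.45) species for G′ with (3.49)) joins it: the leaf receives `Letters313HZc.of_HZ (hLH3 …) (hWE …)`.
NET DISPLAY CHANGE of the `norm_G` storey: the three located letters are gone; the replacements `gXH ∕ wGp` (in `Letters313Zc`), `vDRDG ∕ vGDRD` (in `Letters313L2Pc`), `hWE`,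
`h152`, `Gp ∕ bXH ∕ hκX` are all of printed species ((3.42)₃ ⊕ (3.43)₂ for G₁; (3.44)∕(3.45)∕(3.46)₃ for G′ with (3.49); (3.152)).  Conclusion — the `∃ M₄ a₀ B₀', …
‖Gop (memberIdx …) (cfgV1OfT3 U₀) f‖ ≤ B₀'·‖f‖` text — BYTE-IDENTICAL with ✓p625281; ✓p625281 stays (additive twin).
L-FLOOR (RULING g26-№20, INPUT-LIST §5 item 9): exactly as ✓p625281 — the conclusion quantifies `∀ (hℓ : 4 ≤ ℓ) … (hM8 : 8 ≤ (ℓ+1)^a′)` = L ≥ 5 content (LF-1 root via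
`memberIdx`); NOTHING is delivered at L = 3.
HONEST SCOPE: bookkeeping (the parent's two `obtain`, `choose`, three `have`, one `exact`, with one callee swapped and five binders threaded); every schema ∕ letter ∕ evaluation row
stays a displayed HYPOTHESIS about the genuine operators; N06(d = 3) NOT discharged; nothing here claims EX, the crux, V3∕R3, d = 4 or the mass gap; YM₃ on T³ is ladder rung R3
(RECORD), not the Clay problem.

References: T. Bałaban, CMP **99** (1985) 389–434 [Balaban1985BackgroundPropagators] (Thm 3.13 p.426, Thm 3.10 pp.414–416, (3.42)–(3.47) pp.397–398, (3.130)–(3.138) pp.421–423,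
(3.152)–(3.153) p.426); CMP **102** (1985) 277–309 [Balaban1985Variational] ((14) p.280, (115)–(117) pp.294–295); CMP **99** (1985) 75–102 [Balaban1985RegularSpaces] ((1.33) p.82,
Prop. 6 p.99); CMP **96** (1984) 223–250 [Balaban1984PropagatorsII] (Lemma 2.1 (2.59)–(2.61) pp.233–234).
-/

set_option autoImplicit false

noncomputable section

open scoped Matrix.Norms.L2Operator

namespace Summit.QuantumFields.YangMills.Theorems.Prop7SectET3N06LeavesRecordStepLayerEvalRowsSCut
open Literature.MathematicalPhysics.QuantumFieldTheory.Balaban1983to89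
open Finset B6RandomWalk B6RandomWalkHom B9Thm34Ext B9Thm37GlueCor36 B11SectG B9SectDSup B9Thm37AllNorms
open B9Thm37AllNormsInstances B9FromB6 B9FromB6ModelSignsOn B9SectBStepWhole B9Thm312Whole B9Thm312WholeLeaf B9Thm312WholeLeft B9Thm313Whole
open B9Thm313WholeLeft B9Thm312WholeLeafLeftGlob B9Ineq347CoReading B9SectCDiffDict B9CoRealizesRel B9Thm37Glue B9SectDL2Decay B9RWSums343Holder
open B9RWSumsReadsRel B9RWSumsReadsNbr B9Ineq347 B9Thm312WholeClasses B9Thm312WholeL2 B9Thm312WholeBlocksRel B9Thm312WholeBlocksNbr B9Thm313WholeLeafRel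
open B9Thm312WholeHolder B9Thm312WholeHHolder B9Thm313WholeHolder B9Thm313WholeL2G B9Thm313WholeL2GP B9Thm313WholeInput B9Thm313WholeBlocksNbr B9Thm312WholeLeafAll
open B9RWSums346SecondDiff B9Thm313WholeBlocksNbrRec B9RWSums344InputFam B9Thm312WholeDir B9Thm312WholeBlocksPairM B9Thm313WholeDir B9Thm313WholeDirInput B9Thm313WholeBlocksPairM
open B9Thm313WholeLeafCompletePairM B9Thm312WholeDirB B9Thm313WholeDirInputB B9Thm313WholeBlocksPairMB B9Thm313WholeLeafCompletePairMB B9Thm313WholeBlocksPairMZ B9Thm313WholeBlocksPairMBZ B9Thm313WholeLeafRelZ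
open B9Thm312WholeHZ B9Thm313WholeZ B9Thm313WholeLeftZ B9Thm313WholeHolderZ B9Thm313WholeInputZ B9Thm313WholeDirZ B9Thm313WholeDirInputZ B9Thm313WholeDirInputBZ
open B9Thm313WholeL2GZ B9Thm313WholeL2GPZ B9Thm313WholeDirL2Z B9Thm313WholeLeafCompletePairMBZ
open B6KLevelCensusIndexV1 (KIdx)
open B9GeoNormsKLevelV1 (geo9K)
open B9CoRealizesRelAtLetters (RelB)
open B9GeoLemma21KLevelV1 (geo9K_len_pos)
open B9Thm310Whole (Ops310 StaticOK310 Sizes310 Local342G Identities310)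
open B9RWSums344InputPair (InputLegsPair310 FactorsInputPair310 DirSupHolder310)
open B9RWSums346MixedPair (L2MixedLegs310 FactorsL2Mixed310 DirSup310)
open B9RWSums346Two (L2TwoLegs310 FactorsL2_310)
open B9RWSumsDefinitePins (PinPrims)
open B9RWSumsDefinitePinsPair (PairPrims)
open B9RWSumsDefinitePinsPairM (MixedPrims)
open B9Thm312WholeStepFrom3131 (Letters3131)
open B9Thm312WholeLeftStepFrom3131 (Letters3131H)
open B9Thm312WholeStepDirFrom3131 (Thm33G0DirX)
open B9Thm312WholeRightStepFrom3131 (Letters3131R Thm33G0DivR)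
open Summit.QuantumFields.YangMills.Theorems.Prop7SectET3Members (hd3)
open Summit.QuantumFields.YangMills.Theorems.Prop7SectET3Geometry (geoOK_geo9K)
open Summit.QuantumFields.YangMills.Theorems.Prop7SectET3BgClass (bgT3)
open Summit.QuantumFields.YangMills.Theorems.Prop7SectET3Letters (LettersRowZT3)
open Summit.QuantumFields.YangMills.Theorems.Prop7SectET3N06LeavesRecordCut (t313_of_pins_T3_completePairMBZc)
open B9Thm313WholeRgdFrom3152 (Ids3152)
open B9Thm313WholeLettersCut (Letters313Zc Letters313HZc Letters313L2Pc)
open Summit.QuantumFields.YangMills.Theorems.Prop7SectET3G0LayerFromThm310E (g0_layer_T3_of_thm310_coreB)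
open Summit.QuantumFields.YangMills.Theorems.Prop7SectET3StepDirLayerFromLetters (stepDirB_layer_T3_of_lettersCZ relB_mult_real dist_eq_of_relB_right)
open B9GeoNormsKLevelModelSignsV1 (modelSignsOn_geo9K)
open Summit.QuantumFields.YangMills.Theorems.Prop7SectET3Members (memberIdx)
open Summit.QuantumFields.YangMills.Theorems.Prop7SectET3BgClass (cfgV1OfT3)
open Summit.QuantumFields.YangMills.Theorems.Prop7SectET3ClassTransferRows (normG_row_of_t313_classTransferS)
open Summit.QuantumFields.YangMills.Theorems.Prop7SectET3KernelFamilyCanonical (exists_kernelFamily_structural)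
open Summit.QuantumFields.YangMills.Theorems.Prop7SectET3OpsSymmetry (hsymGG_row_of_letterSymm)
open T3ContinuumYM3Torus T3PrintedRegularMinimiser B6GlobalChartV1

variable {ℓ : ℕ} {hL : Odd (ℓ + 1) ∧ 1 < ℓ + 1} {c35 : ℝ}

set_option maxHeartbeats 400000 in
/-- (**RE-CUT TWIN** of ✓`normG_row_of_letterLayers_evaluationRowsS`: `hletters` valued in `Letters313Zc` (inline row), `hLL2` in `Letters313L2Pc ∧ Letters313L2MZ`, new `Gp bXH hκX h152 hWE`; `hLH3 : Letters313HZ` kept for the StepDir layer's `pXDv`; conclusion byte-identical; proof verbatim over `t313_of_pins_T3_completePairMBZc`.) ★★★ **THE `norm_G` ROW OF C-min FROM THEOREM 3.10's SCHEMAS + THE SECT.-D LETTER LAYER + K-FREE EVALUATION ROWS + ONE LETTER-SYMMETRY ROW + ONE READOUT ROW + (BG-336)′**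
(module docstring): `normG_row_of_t313_classTransferS` ∘ `t313_of_pins_T3_completePairMBZ` with `hmodel hleft hG0C hG0L2 hstepD` SUPPLIED by `g0_layer_T3_of_thm310_coreB` (face E)
and `stepDirB_layer_T3_of_lettersCZ` (at `Rel := RelB`, multiplicity 6), with `GG hcoR hco1R hcoG hl2N hH1N hIF` SUPPLIED by `exists_kernelFamily_structural` from the evaluation rows,
`hsymGG` by `hsymGG_row_of_letterSymm` from the DERIVED `Identities` and `hls`, `hglob` from the dominations and `hread`, and the class-transfer input in the ∃-shape `hCTS`; band
`b₀ = b₁ = 1`; the leaf is read at the layers' thresholds `(M₀′, a₀)`.  Conclusion VERBATIM = the EX knit's `norm_G` row.  Nothing of print asserted; NOT a discharge of N06(d = 3);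
nothing at L = 3 (`4 ≤ ℓ` in the conclusion).
[cite: Balaban1985Variational, (117) p.295, (14) p.280; Balaban1985BackgroundPropagators, Thm 3.13 p.426, Thm 3.10 (3.105)-(3.108) pp.414-416, (3.47) p.398, (3.130)-(3.138) pp.421-423; Balaban1985RegularSpaces, (1.33) p.82, Prop. 6 p.99; Balaban1984PropagatorsII, Lemma 2.1 (2.59)-(2.61) pp.233-234] -/
theorem normG_row_of_letterLayers_evaluationRowsSc
    [∀ i : KIdx 2 ℓ hd3 hL 1 1, Fintype (geo9K i).Site] [∀ i : KIdx 2 ℓ hd3 hL 1 1, DecidableEq (geo9K i).Site]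
    [∀ i : KIdx 2 ℓ hd3 hL 1 1, DecidableRel (RelB i)]
    {X Y ι A PX PY Z W : KIdx 2 ℓ hd3 hL 1 1 → Type} {P : Type}
    [∀ x, Fintype (X x)] [∀ x, DecidableEq (X x)] [∀ x, Fintype (Y x)] [∀ x, DecidableEq (Y x)] [∀ x, Fintype (ι x)]
    [∀ x, Fintype (A x)] [∀ x, Fintype (PX x)] [∀ x, DecidableEq (PX x)] [∀ x, Fintype (PY x)] [∀ x, DecidableEq (PY x)]
    [∀ x, Fintype (Z x)] [∀ x, Fintype (W x)] [Fintype P]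
    (hc35 : 0 < c35) (q : PinPrims) (hq : q.OK) (q3 : PairPrims) (hq3 : q3.OK) (qM : MixedPrims) (hqM : qM.OK)
    (H : KIdx 2 ℓ hd3 hL 1 1 → Prop)
    -- ======== Theorem 3.10's letters and schemas for G₀ = G(U) (rows 18–19, G side), as in ★w1's `…N06LeavesRelZFromThm310` ========
    (𝔬A : ∀ x : KIdx 2 ℓ hd3 hL 1 1, Ops310 (geo9K x) (bgT3 x) (X x) (Y x) (ι x) (A x))
    (𝔭A : ∀ x : KIdx 2 ℓ hd3 hL 1 1, HolderProbes (geo9K x) (bgT3 x) (X x) (Y x) (PX x) (PY x))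
    (𝔡A : ∀ x : KIdx 2 ℓ hd3 hL 1 1, DirOps310 (𝔬A x) P)
    (bHXA : ∀ x : KIdx 2 ℓ hd3 hL 1 1, ℝ → BlockNorm (toB6 (geo9K x) 1 (H x)) (X x → ℝ))
    (κA : KIdx 2 ℓ hd3 hL 1 1 → Sizes310)
    (SHA S3A SIA SMA S2A : ∀ x : KIdx 2 ℓ hd3 hL 1 1, ι x → Finset (geo9K x).Site)
    (hstA : ∀ x, StaticOK310 (𝔬A x) q.ρ q.Nc q.N' q.NF q.Cℓ (κA x)) (hκA : ∀ x, (κA x).Bounded q.Kc)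
    (h36A : ∀ x, q.M₁ ≤ (geo9K x).M → ∀ α₀ : ℝ, 0 < α₀ → c35 * (geo9K x).M * α₀ ≤ q.a₁ →
      ∀ U : (bgT3 x).Cfg, (bgT3 x).Reg335 c35 α₀ U →
        Local342G (𝔬A x) 1 (H x) q.B₀ q.δ₀ U ∧ B9Thm310Whole.Factors389 (𝔬A x) 1 (H x) q.θ₀ q.δ₀ U ∧
          Identities310 (𝔬A x) 1 (H x) U)
    (h36HA : ∀ x, q.M₁ ≤ (geo9K x).M → ∀ α₀ : ℝ, 0 < α₀ → c35 * (geo9K x).M * α₀ ≤ q.a₁ →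
      ∀ U : (bgT3 x).Cfg, (bgT3 x).Reg335 c35 α₀ U →
        HolderLegs310 (𝔬A x) (𝔭A x) 1 (H x) (SHA x) q.Bl q.δ₀ U ∧ FactorsHolder310 (𝔬A x) (𝔭A x) 1 (H x) q.Bt q.δ₀ U ∧
          (L2SecondLegs310 (𝔬A x) (𝔡A x) 1 (H x) (S3A x) q3.B3 q.δ₀ U ∧ FactorsL2Second310 (𝔬A x) (𝔡A x) 1 (H x) q3.θ3 q.δ₀ U ∧
            DirTranspose310 (𝔬A x) (𝔡A x) U) ∧
            (InputLegsPair310 (𝔬A x) (𝔡A x) (𝔭A x) 1 (H x) (bHXA x) (SIA x) q.BI q.BI2 q.δ₀ U ∧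
              FactorsInputPair310 (𝔬A x) (𝔡A x) 1 (H x) (bHXA x) q.θI q.δ₀ U ∧ DirSupHolder310 (𝔬A x) (𝔡A x) (𝔭A x) 1 (H x) U) ∧
              (L2MixedLegs310 (𝔬A x) (𝔡A x) 1 (H x) (SMA x) qM.BM q.δ₀ U ∧ FactorsL2Mixed310 (𝔬A x) (𝔡A x) 1 (H x) qM.θM q.δ₀ U ∧
                DirSup310 (𝔬A x) (𝔡A x) 1 (H x) U))
    (h36A2 : ∀ x, q.M₁ ≤ (geo9K x).M → ∀ α₀ : ℝ, 0 < α₀ → c35 * (geo9K x).M * α₀ ≤ q.a₁ →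
      ∀ U : (bgT3 x).Cfg, (bgT3 x).Reg335 c35 α₀ U →
        L2TwoLegs310 (𝔬A x) 1 (H x) (S2A x) q.B2 q.δ₀ U ∧ FactorsL2_310 (𝔬A x) 1 (H x) q.θ2 q.δ₀ U)
    (hcntHA : ∀ x (a : (geo9K x).Site), (∑ c, if a ∈ SHA x c then (1 : ℝ) else 0) ≤ q.NH)
    (hcnt3A : ∀ x (a : (geo9K x).Site), (∑ c, if a ∈ S3A x c then (1 : ℝ) else 0) ≤ q3.N3)
    (hcntIA : ∀ x (a : (geo9K x).Site), (∑ c, if a ∈ SIA x c then (1 : ℝ) else 0) ≤ q.NI)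
    (hcntMA : ∀ x (a : (geo9K x).Site), (∑ c, if a ∈ SMA x c then (1 : ℝ) else 0) ≤ qM.NM)
    (hcnt2A : ∀ x (a : (geo9K x).Site), (∑ c, if a ∈ S2A x c then (1 : ℝ) else 0) ≤ q.N2)
    (hsymA : ∀ x, q.M₁ ≤ (geo9K x).M → ∀ α₀ : ℝ, 0 < α₀ → c35 * (geo9K x).M * α₀ ≤ q.a₁ →
      ∀ U : (bgT3 x).Cfg, (bgT3 x).Reg335 c35 α₀ U → IsTransposePair ((𝔬A x).G U) ((𝔬A x).G U))
    (htrA : ∀ x, q.M₁ ≤ (geo9K x).M → ∀ α₀ : ℝ, 0 < α₀ → c35 * (geo9K x).M * α₀ ≤ q.a₁ →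
      ∀ U : (bgT3 x).Cfg, (bgT3 x).Reg335 c35 α₀ U →
        IsTransposePair ((𝔬A x).D U ∘ₗ (𝔬A x).G U) ((𝔬A x).G U ∘ₗ (𝔬A x).Dstar U))
    -- ======== the Theorem-3.12 letter record of the leaf and the identification G₀ := G(U) ========
    (𝔬12 : ∀ x : KIdx 2 ℓ hd3 hL 1 1, B9Thm312Whole.Ops (geo9K x) (bgT3 x) (X x) (Y x) (Z x) (W x))
    (hblk : ∀ x, (𝔬12 x).blk = (𝔬A x).blk) (hblkY : ∀ x, (𝔬12 x).blkY = (𝔬A x).blkY)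
    (hG0 : ∀ x (U : (bgT3 x).Cfg), (𝔬12 x).G0 U = (𝔬A x).G U) (hD : ∀ x (U : (bgT3 x).Cfg), (𝔬12 x).D U = (𝔬A x).D U)
    (hDs : ∀ x (U : (bgT3 x).Cfg), (𝔬12 x).Dstar U = (𝔬A x).Dstar U)
    -- ======== the Sect.-D numerics (regime (M12, a12) of the displayed rows; the rates with their ONE relation) ========
    (θ2₁₂ δ12₀ δK12 a12 M12 B12₃ δ12₃ t12 δT12 ρS σS κ₀ : ℝ) (ha12 : 0 < a12) (hM12 : 0 < M12) (hθ2₁₂ : 0 ≤ θ2₁₂)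
    (hδ12₀ : δ12₀ ≤ (1 - 3 * q.αF) * ((1 - 2 * q.α) * q.δ₀)) (hB12₃ : 0 ≤ B12₃) (ht12 : 0 ≤ t12)
    (bH13 : ∀ x : KIdx 2 ℓ hd3 hL 1 1, BlockNorm (toB6 (geo9K x) 1 (H x)) (W x → ℝ)) (hκ13 : ∀ x, (bH13 x).κ ≤ κ₀)
    (bHW13 : ∀ x : KIdx 2 ℓ hd3 hL 1 1, ℝ → BlockNorm (toB6 (geo9K x) 1 (H x)) (W x → ℝ)) (hκW : ∀ (x : KIdx 2 ℓ hd3 hL 1 1) (ε : ℝ), (bHW13 x ε).κ ≤ κ₀)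
    (Gp : ∀ x : KIdx 2 ℓ hd3 hL 1 1, (bgT3 x).Cfg → Module.End ℝ (W x → ℝ))
    (bXH : ∀ x : KIdx 2 ℓ hd3 hL 1 1, BlockNorm (toB6 (geo9K x) 1 (H x)) (X x → ℝ)) (hκX : ∀ x, (bXH x).κ ≤ κ₀)
    (hσS : 0 < σS) (hρS : 0 ≤ ρS) (hρST : ρS ≤ δT12) (hρS₀ : ρS + σS ≤ δ12₀) (hρS₃ : ρS + σS ≤ δ12₃)
    (hδKS : δK12 + q.αF * ((1 - 2 * q.α) * q.δ₀) ≤ ρS) (hσSK : σS ≤ δK12) (hδK0 : 0 ≤ δK12)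
    -- ======== the letter layer replacing `hmodel`∕`hleft`∕`hG0C`∕`hstepD` ========
    (hpos12 : ∀ x : KIdx 2 ℓ hd3 hL 1 1, M12 ≤ (geo9K x).M → ∀ α₀ : ℝ, 0 < α₀ → (geo9K x).M * α₀ ≤ a12 →
      ∀ U : (bgT3 x).Cfg, (bgT3 x).Reg335 c35 α₀ U → (bgT3 x).Reg336 c35 α₀ U → PosDefEnd ((𝔬12 x).S0 U))
    (hinv12 : ∀ x : KIdx 2 ℓ hd3 hL 1 1, M12 ≤ (geo9K x).M → ∀ α₀ : ℝ, 0 < α₀ → (geo9K x).M * α₀ ≤ a12 →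
      ∀ U : (bgT3 x).Cfg, (bgT3 x).Reg335 c35 α₀ U → (bgT3 x).Reg336 c35 α₀ U → (𝔬12 x).G0 U * (𝔬12 x).S0 U = 1)
    (hIdOfForm : ∀ x : KIdx 2 ℓ hd3 hL 1 1, M12 ≤ (geo9K x).M → ∀ α₀ : ℝ, 0 < α₀ → (geo9K x).M * α₀ ≤ a12 →
      ∀ U : (bgT3 x).Cfg, (bgT3 x).Reg335 c35 α₀ U → (bgT3 x).Reg336 c35 α₀ U →
        ∀ r : ℝ, r < 1 → FormSmall (𝔬12 x) r U → B9Thm312Whole.Identities (𝔬12 x) U)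
    (Ta Ta₂ Ta' Ta₂' : ∀ x : KIdx 2 ℓ hd3 hL 1 1, (bgT3 x).Cfg → Module.End ℝ (X x → ℝ))
    (Tb Tb₂ : ∀ x : KIdx 2 ℓ hd3 hL 1 1, (bgT3 x).Cfg → (X x → ℝ) →ₗ[ℝ] (W x → ℝ))
    (Tb' Tb₂' : ∀ x : KIdx 2 ℓ hd3 hL 1 1, (bgT3 x).Cfg → (W x → ℝ) →ₗ[ℝ] (X x → ℝ))
    (hL3131 : ∀ x : KIdx 2 ℓ hd3 hL 1 1, M12 ≤ (geo9K x).M → ∀ α₀ : ℝ, 0 < α₀ → (geo9K x).M * α₀ ≤ a12 →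
      ∀ U : (bgT3 x).Cfg, (bgT3 x).Reg335 c35 α₀ U → (bgT3 x).Reg336 c35 α₀ U →
        Letters3131 (𝔬12 x) (Ta x) (Ta₂ x) (Tb x) (Tb₂ x) 1 (H x) (fun y => (geo9K_len_pos x y).le) (t12 * ((geo9K x).M * α₀)) δT12 U)
    (hL3131H : ∀ x : KIdx 2 ℓ hd3 hL 1 1, M12 ≤ (geo9K x).M → ∀ α₀ : ℝ, 0 < α₀ → (geo9K x).M * α₀ ≤ a12 →
      ∀ U : (bgT3 x).Cfg, (bgT3 x).Reg335 c35 α₀ U → (bgT3 x).Reg336 c35 α₀ U →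
        Letters3131H (𝔬12 x) (Tb x) (Tb₂ x) 1 (H x) (fun y => (geo9K_len_pos x y).le) (bH13 x) (t12 * ((geo9K x).M * α₀)) δT12 U)
    (hR : ∀ x : KIdx 2 ℓ hd3 hL 1 1, M12 ≤ (geo9K x).M → ∀ α₀ : ℝ, 0 < α₀ → (geo9K x).M * α₀ ≤ a12 →
      ∀ U : (bgT3 x).Cfg, (bgT3 x).Reg335 c35 α₀ U → (bgT3 x).Reg336 c35 α₀ U →
        Letters3131R (𝔬12 x) (Ta' x) (Ta₂' x) (Tb' x) (Tb₂' x) 1 (H x) (fun y => (geo9K_len_pos x y).le) (t12 * ((geo9K x).M * α₀)) δT12 U)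
    (hstepL2 : ∀ x : KIdx 2 ℓ hd3 hL 1 1, M12 ≤ (geo9K x).M → ∀ α₀ : ℝ, 0 < α₀ → (geo9K x).M * α₀ ≤ a12 →
      ∀ U : (bgT3 x).Cfg, (bgT3 x).Reg335 c35 α₀ U → (bgT3 x).Reg336 c35 α₀ U →
        StepL2 (𝔬12 x) 1 (H x) (θ2₁₂ * ((geo9K x).M * α₀)) δK12 U)
    (Bq12 BhD13 Bx13 Bx0 BdX BiD BdD : ℝ → ℝ)
    (hBq12 : ∀ β, 0 ≤ β → β < 1 → 0 ≤ Bq12 β) (hBhD13 : ∀ β, 0 ≤ β → β < 1 → 0 ≤ BhD13 β) (hBx13 : ∀ β, 0 ≤ β → β < 1 → 0 ≤ Bx13 β)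
    (hBx0 : ∀ β, 0 ≤ β → β < 1 → 0 ≤ Bx0 β) (hBdX : ∀ β, 0 ≤ β → β < 1 → 0 ≤ BdX β) (hBiD : ∀ ε, 0 < ε → 0 ≤ BiD ε)
    (hX : ∀ x : KIdx 2 ℓ hd3 hL 1 1, M12 ≤ (geo9K x).M → ∀ α₀ : ℝ, 0 < α₀ → (geo9K x).M * α₀ ≤ a12 →
      ∀ U : (bgT3 x).Cfg, (bgT3 x).Reg335 c35 α₀ U → (bgT3 x).Reg336 c35 α₀ U →
        Thm33G0DirX (𝔬12 x) (𝔭A x) (𝔡A x).Dd 1 (H x) (fun y => (geo9K_len_pos x y).le) (bH13 x) Bx0 BdX δ12₀ δ12₃ U)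
    (hdiv : ∀ x : KIdx 2 ℓ hd3 hL 1 1, M12 ≤ (geo9K x).M → ∀ α₀ : ℝ, 0 < α₀ → (geo9K x).M * α₀ ≤ a12 →
      ∀ U : (bgT3 x).Cfg, (bgT3 x).Reg335 c35 α₀ U → (bgT3 x).Reg336 c35 α₀ U →
        Thm33G0DivR (𝔬12 x) (𝔡A x).Dsd 1 (H x) (fun y => (geo9K_len_pos x y).le) (bHXA x) (bHW13 x) BiD BdD δ12₀ δ12₃ U)
    (hvanishX : ∀ x : KIdx 2 ℓ hd3 hL 1 1, M12 ≤ (geo9K x).M → ∀ α₀ : ℝ, 0 < α₀ → (geo9K x).M * α₀ ≤ a12 →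
      ∀ U : (bgT3 x).Cfg, (bgT3 x).Reg335 c35 α₀ U → (bgT3 x).Reg336 c35 α₀ U →
        ∀ ε : ℝ, 0 < ε → ∀ (y' : (geo9K x).Site) (μ : X x → ℝ), (bHXA x ε).IsLoc y' μ → ∀ y'' : (geo9K x).Site, ¬ RelB x y'' y' →
          (BlockNorm.ofBlocks (toB6 (geo9K x) 1 (H x)) (𝔬12 x).blk).cut y'' μ = 0)
    (hleX : ∀ x : KIdx 2 ℓ hd3 hL 1 1, M12 ≤ (geo9K x).M → ∀ α₀ : ℝ, 0 < α₀ → (geo9K x).M * α₀ ≤ a12 →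
      ∀ U : (bgT3 x).Cfg, (bgT3 x).Reg335 c35 α₀ U → (bgT3 x).Reg336 c35 α₀ U →
        ∀ ε : ℝ, 0 < ε → ∀ (y' : (geo9K x).Site) (μ : X x → ℝ), (bHXA x ε).IsLoc y' μ → ∀ y'' : (geo9K x).Site, RelB x y'' y' →
          (BlockNorm.ofBlocks (toB6 (geo9K x) 1 (H x)) (𝔬12 x).blk).loc y'' ((BlockNorm.ofBlocks (toB6 (geo9K x) 1 (H x)) (𝔬12 x).blk).cut y'' μ) ≤ (bHXA x ε).loc y' μ)
    -- ======== the leaf's evaluation maps and numerics, VERBATIM (`Prop7SectET3N06LeavesRecord.t313_of_pins_T3_completePairMBZ`) ========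
    (ev : ∀ x : KIdx 2 ℓ hd3 hL 1 1, (geo9K x).Loc → X x → ℝ) (evY : ∀ x : KIdx 2 ℓ hd3 hL 1 1, (geo9K x).Loc → Y x → ℝ)
    (r Cev B₄ σ ρ ρ' α : ℝ) (Bd θV Br : ℝ → ℝ) (Bd2 : ℝ → ℝ → ℝ)
    (hθV : ∀ ε, 0 < ε → 0 ≤ θV ε) (hB₄ : 0 ≤ B₄) (hBr : ∀ ε, 0 < ε → 0 ≤ Br ε) (hσ : 0 < σ) (hρ' : 0 < ρ') (hρ'ρ : ρ' + 3 * σ ≤ ρ)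
    (hρ'ρ₅ : ρ' + 5 * σ ≤ ρ) (hσρ' : 3 * σ < (1 - α) * ρ') (hρ0 : ρ ≤ δ12₀) (hρ₃ : ρ ≤ δ12₃) (hρδ : ρ + σ ≤ δK12)
    (hα0 : 0 < α) (hα1 : α < 1) (hBd : ∀ ε, 0 < ε → ε ≤ 1 → 0 ≤ Bd ε) (hBd2 : ∀ ε β, 0 < ε → ε ≤ 1 → 0 ≤ β → β < 1 → 0 ≤ Bd2 ε β)
    (hCev : 0 ≤ Cev)
    -- ======== the TEN K-free EVALUATION ROWS (replace the kernel family `GG` and its six co-reading rows) ========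
    (hoff : ∀ (i : KIdx 2 ℓ hd3 hL 1 1) (lam : (geo9K i).Loc) (y' : (geo9K i).Site), (geo9K i).suppIn lam y' →
      ∀ x : X i, ¬ RelB i ((𝔬12 i).blk x) y' → ev i lam x = 0)
    (hoffY : ∀ (i : KIdx 2 ℓ hd3 hL 1 1) (lam : (geo9K i).Loc) (y' : (geo9K i).Site), (geo9K i).suppIn lam y' →
      ∀ w : Y i, ¬ RelB i ((𝔬12 i).blkY w) y' → evY i lam w = 0)
    (hbd : ∀ (i : KIdx 2 ℓ hd3 hL 1 1) (lam : (geo9K i).Loc) (x : X i), |ev i lam x| ≤ (geo9K i).supNorm lam)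
    (hbdY : ∀ (i : KIdx 2 ℓ hd3 hL 1 1) (lam : (geo9K i).Loc) (w : Y i), |evY i lam w| ≤ (geo9K i).supNorm lam)
    (hwb : ∀ (i : KIdx 2 ℓ hd3 hL 1 1) (lam : (geo9K i).Loc) (γ : ℝ) (x : X i), |ev i lam x| ≤ (geo9K i).len ((𝔬12 i).blk x) ^ γ * (geo9K i).wNorm γ lam)
    (hwbY : ∀ (i : KIdx 2 ℓ hd3 hL 1 1) (lam : (geo9K i).Loc) (γ : ℝ) (w : Y i), |evY i lam w| ≤ (geo9K i).len ((𝔬12 i).blkY w) ^ γ * (geo9K i).wNorm γ lam)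
    (hl2b : ∀ (i : KIdx 2 ℓ hd3 hL 1 1) (lam : (geo9K i).Loc) (y' y'' : (geo9K i).Site), (geo9K i).suppIn lam y' → RelB i y'' y' →
      bl2 (g := toB6 (geo9K i) 1 (H i)) (𝔬12 i).blk y'' (ev i lam) ≤ Cev * (geo9K i).l2Norm lam)
    (hl2bY : ∀ (i : KIdx 2 ℓ hd3 hL 1 1) (lam : (geo9K i).Loc) (y' y'' : (geo9K i).Site), (geo9K i).suppIn lam y' → RelB i y'' y' →
      bl2 (g := toB6 (geo9K i) 1 (H i)) (𝔬12 i).blkY y'' (evY i lam) ≤ Cev * (geo9K i).l2Norm lam)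
    (hloc : ∀ (i : KIdx 2 ℓ hd3 hL 1 1) (ε : ℝ) (lam : (geo9K i).Loc) (y' : (geo9K i).Site), (geo9K i).suppInT lam y' → (bHXA i ε).IsLoc y' (ev i lam))
    (hlocle : ∀ (i : KIdx 2 ℓ hd3 hL 1 1) (ε : ℝ) (lam : (geo9K i).Loc) (y' : (geo9K i).Site), (geo9K i).suppInT lam y' →
      (bHXA i ε).loc y' (ev i lam) ≤ (geo9K i).holder ε lam + (geo9K i).supNorm lam)
    -- ======== the LETTER-SYMMETRY ROW (replaces `hsymGG`) ========
    (hls : ∀ i : KIdx 2 ℓ hd3 hL 1 1, M12 ≤ (geo9K i).M → ∀ α₀ : ℝ, 0 < α₀ → (geo9K i).M * α₀ ≤ a12 →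
      ∀ U : (bgT3 i).Cfg, (bgT3 i).Reg335 c35 α₀ U → (bgT3 i).Reg336 c35 α₀ U →
        IsTransposePair ((𝔬12 i).S0 U) ((𝔬12 i).S0 U) ∧ IsTransposePair ((𝔬12 i).Tpi U) ((𝔬12 i).Tpi U) ∧
          IsTransposePair ((𝔬12 i).T2 U) ((𝔬12 i).T2 U) ∧ IsTransposePair ((𝔬12 i).D U) ((𝔬12 i).Dstar U))
    (wZ : ∀ x : KIdx 2 ℓ hd3 hL 1 1, (geo9K x).Site → ℝ) (hwZ : ∀ x y, 0 < wZ x y)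
    (hletters : ∀ x : KIdx 2 ℓ hd3 hL 1 1, M12 ≤ (geo9K x).M → ∀ α₀ : ℝ, 0 < α₀ → (geo9K x).M * α₀ ≤ a12 →
      ∀ U : (bgT3 x).Cfg, (bgT3 x).Reg335 c35 α₀ U → (bgT3 x).Reg336 c35 α₀ U →
        Letters313Zc (𝔬12 x) (Gp x) 1 (H x) (geoOK_geo9K x) (wZ x) (hwZ x) B12₃ δ12₃ (bXH x) U)
    (h152 : ∀ x : KIdx 2 ℓ hd3 hL 1 1, M12 ≤ (geo9K x).M → ∀ α₀ : ℝ, 0 < α₀ → (geo9K x).M * α₀ ≤ a12 →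
      ∀ U : (bgT3 x).Cfg, (bgT3 x).Reg335 c35 α₀ U → (bgT3 x).Reg336 c35 α₀ U → Ids3152 (𝔬12 x) (Gp x) U)
    (hlettersD : ∀ x : KIdx 2 ℓ hd3 hL 1 1, M12 ≤ (geo9K x).M → ∀ α₀ : ℝ, 0 < α₀ → (geo9K x).M * α₀ ≤ a12 →
      ∀ U : (bgT3 x).Cfg, (bgT3 x).Reg335 c35 α₀ U → (bgT3 x).Reg336 c35 α₀ U →
        Letters313DZ (𝔬12 x) 1 (H x) (geoOK_geo9K x) (wZ x) (hwZ x) B12₃ δ12₃ (bH13 x) U ∧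
          Letters313DMZ (𝔬12 x) (𝔭A x) (𝔡A x).Dd 1 (H x) (geoOK_geo9K x) (wZ x) (hwZ x) B12₃ Bq12 δ12₃ (bH13 x) U)
    (hLHH : ∀ x : KIdx 2 ℓ hd3 hL 1 1, M12 ≤ (geo9K x).M → ∀ α₀ : ℝ, 0 < α₀ → (geo9K x).M * α₀ ≤ a12 →
      ∀ U : (bgT3 x).Cfg, (bgT3 x).Reg335 c35 α₀ U → (bgT3 x).Reg336 c35 α₀ U →
        LettersHHZ (𝔬12 x) (𝔭A x) 1 (H x) (geoOK_geo9K x).lenle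
          (weightNorm (BlockNorm.ofBlocks (toB6 (geo9K x) 1 (H x)) (𝔬12 x).blkZ) (wZ x) fun y => (hwZ x y).le) Bq12 δ12₃ U)
    (hLH3 : ∀ x : KIdx 2 ℓ hd3 hL 1 1, M12 ≤ (geo9K x).M → ∀ α₀ : ℝ, 0 < α₀ → (geo9K x).M * α₀ ≤ a12 →
      ∀ U : (bgT3 x).Cfg, (bgT3 x).Reg335 c35 α₀ U → (bgT3 x).Reg336 c35 α₀ U →
        Letters313HZ (𝔬12 x) (𝔭A x) 1 (H x) (geoOK_geo9K x) (wZ x) (hwZ x) (bH13 x) BhD13 Bx13 δ12₃ U)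
    (hWE : ∀ x : KIdx 2 ℓ hd3 hL 1 1, M12 ≤ (geo9K x).M → ∀ α₀ : ℝ, 0 < α₀ → (geo9K x).M * α₀ ≤ a12 →
      ∀ U : (bgT3 x).Cfg, (bgT3 x).Reg335 c35 α₀ U → (bgT3 x).Reg336 c35 α₀ U → ∀ β : ℝ, 0 ≤ β → β < 1 →
        HasMaj (bXH x) (cNormR 1 (H x) (𝔭A x).blkPX (geoOK_geo9K x).lenle (β - 1))
          ((𝔭A x).ΦX U β ∘ₗ ((𝔬12 x).Dv U ∘ₗ Gp x U ∘ₗ (𝔬12 x).R U ∘ₗ (𝔬12 x).Dvstar U))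
          (fun a b => Bx13 β * Real.exp (-(δ12₃ * (geo9K x).dist a b))))
    (vZ : ∀ x : KIdx 2 ℓ hd3 hL 1 1, (geo9K x).Site → ℝ) (hvZ : ∀ x y, 0 < vZ x y)
    (hLL2 : ∀ x : KIdx 2 ℓ hd3 hL 1 1, M12 ≤ (geo9K x).M → ∀ α₀ : ℝ, 0 < α₀ → (geo9K x).M * α₀ ≤ a12 →
      ∀ U : (bgT3 x).Cfg, (bgT3 x).Reg335 c35 α₀ U → (bgT3 x).Reg336 c35 α₀ U →
        Letters313L2Pc (𝔬12 x) (𝔡A x).Dd (𝔡A x).Dsd 1 (H x) B₄ δ12₃ (vZ x) (hvZ x) U ∧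
          Letters313L2MZ (𝔬12 x) (𝔡A x).Dd (𝔡A x).Dsd 1 (H x) B₄ δ12₃ (vZ x) (hvZ x) U)
    (hLIM : ∀ x : KIdx 2 ℓ hd3 hL 1 1, M12 ≤ (geo9K x).M → ∀ α₀ : ℝ, 0 < α₀ → (geo9K x).M * α₀ ≤ a12 →
      ∀ U : (bgT3 x).Cfg, (bgT3 x).Reg335 c35 α₀ U → (bgT3 x).Reg336 c35 α₀ U →
        Letters313IMB (𝔬12 x) (𝔭A x) (𝔡A x).Dd (𝔡A x).Dsd 1 (H x) (geoOK_geo9K x).lenle (bHXA x) (bHW13 x) Br (fun ε => θV ε * ((geo9K x).M * α₀))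
          Bd Bd2 δ12₃ δK12 U)
    -- ======== the class-transfer row in the ∃-shape (BG-336)′ of ✓`Prop7SectET3ClassTransferRows` (discharged by `reg335_reg336_T3_of_regPr` for `c35 ≥ c35₀(L)`), the normed family, its weight pin and the readout row ========
    (hCTS : ∃ a₅ : ℝ, 0 < a₅ ∧ ∀ (hℓ : 4 ≤ ℓ) (m : ℕ) (hm : 1 ≤ m) (n K a' R : ℕ) (hk1 : 1 ≤ K - n) (hsize : a' + 3 ≤ m + n) (hM8 : 8 ≤ (ℓ + 1) ^ a')
      (hR2 : 2 * (ℓ + 1) ^ 2 ≤ R) (α₀ : ℝ), 0 < α₀ → ((ℓ + 1 : ℕ) : ℝ) * (((ℓ + 1) ^ a' : ℕ) : ℝ) * α₀ ≤ a₅ →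
      ∀ U₀ : GaugeField (PV 2 ℓ m K hd3 hL) 0 (Matrix.specialUnitaryGroup (Fin 2) ℂ), RegPr (⟨ℓ + 1, hL, m, hm⟩ : T3Family) n K α₀ U₀ →
        (bgT3 (memberIdx ℓ hL hℓ m hm n K a' R hk1 hsize hM8 hR2)).Reg335 c35 α₀ (cfgV1OfT3 U₀) ∧
          (bgT3 (memberIdx ℓ hL hℓ m hm n K a' R hk1 hsize hM8 hR2)).Reg336 c35 α₀ (cfgV1OfT3 U₀))
    {Xo Yo : ∀ i : KIdx 2 ℓ hd3 hL 1 1, (bgT3 i).Cfg → Type} [∀ i U, SeminormedAddCommGroup (Xo i U)] [∀ i U, SeminormedAddCommGroup (Yo i U)]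
    (Gop : ∀ (i : KIdx 2 ℓ hd3 hL 1 1) (U : (bgT3 i).Cfg), Xo i U → Yo i U) (ιo : ∀ (i : KIdx 2 ℓ hd3 hL 1 1) (U : (bgT3 i).Cfg), Xo i U → (geo9K i).Loc)
    (hw : ∀ (i : KIdx 2 ℓ hd3 hL 1 1) (U : (bgT3 i).Cfg) (f : Xo i U), (geo9K i).wNorm (-3) (ιo i U f) ≤ ‖f‖)
    (hread : ∀ (i : KIdx 2 ℓ hd3 hL 1 1) (U : (bgT3 i).Cfg) (f : Xo i U) (C : ℝ), 0 ≤ C →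
      (∀ x : X i, |(𝔬12 i).GG U (ev i (ιo i U f)) x| ≤ C * B9.pref4 ((geo9K i).len ((𝔬12 i).blk x)) 0 * (geo9K i).len ((𝔬12 i).blk x) ^ (-3 : ℝ)) →
      (∀ w : Y i, |((𝔬12 i).D U ∘ₗ (𝔬12 i).GG U) (ev i (ιo i U f)) w| ≤ C * B9.pref4 ((geo9K i).len ((𝔬12 i).blkY w)) 1 * (geo9K i).len ((𝔬12 i).blkY w) ^ (-3 : ℝ)) →
        ‖Gop i U f‖ ≤ C) :
    ∃ M₄ a₀ B₀' : ℝ, 0 < M₄ ∧ 0 < a₀ ∧ 0 < B₀' ∧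
      ∀ (hℓ : 4 ≤ ℓ) (m : ℕ) (hm : 1 ≤ m) (n K a' R : ℕ) (hk1 : 1 ≤ K - n) (hsize : a' + 3 ≤ m + n) (hM8 : 8 ≤ (ℓ + 1) ^ a') (hR2 : 2 * (ℓ + 1) ^ 2 ≤ R),
        M₄ ≤ ((ℓ + 1 : ℕ) : ℝ) * (((ℓ + 1) ^ a' : ℕ) : ℝ) →
        ∀ (e : ℝ) (U₀ : GaugeField (PV 2 ℓ m K hd3 hL) 0 (Matrix.specialUnitaryGroup (Fin 2) ℂ)),
          RegPr (⟨ℓ + 1, hL, m, hm⟩ : T3Family) n K e U₀ → e ≤ a₀ / (((ℓ + 1 : ℕ) : ℝ) * (((ℓ + 1) ^ a' : ℕ) : ℝ)) →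
            ∀ f : Xo (memberIdx ℓ hL hℓ m hm n K a' R hk1 hsize hM8 hR2) (cfgV1OfT3 U₀),
              ‖Gop (memberIdx ℓ hL hℓ m hm n K a' R hk1 hsize hM8 hR2) (cfgV1OfT3 U₀) f‖ ≤ B₀' * ‖f‖ := by
  -- the face-E G₀ layer: Thm33G0, the two Steps, LeftStep (θ_D chosen), FormSmall (r₁₂ chosen), Identities, the G₀ direction rows, in (M₀, a₀)
  obtain ⟨B12₀, Bh12, Bi12, Bi2₁₂, B12₂, θ12, θD, r12, M₀, a₀, hB12₀, hBh12, hBi12, hBi2₁₂, hB12₂, hθ12, hθD, hr12, hM₀, ha₀, hMM, haa,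
      hmodel12, hleft12, hG0C⟩ :=
    g0_layer_T3_of_thm310_coreB (bg := bgT3) (P := fun _ => P) hc35 q hq q3 hq3 qM hqM H 𝔬A 𝔭A 𝔡A bHXA κA SHA S3A SIA SMA S2A hstA hκA h36A h36HA
      h36A2 hcntHA hcnt3A hcntIA hcntMA hcnt2A hsymA htrA 𝔬12 hblk hblkY hG0 hD hDs θ2₁₂ δ12₀ δK12 a12 M12 B12₃ δ12₃ t12 δT12 ρS σS κ₀ ha12 hM12
      hθ2₁₂ hδ12₀ hB12₃ ht12 bH13 hκ13 hσS hρS hρST hρS₀ hρS₃ hδKS hσSK hpos12 hinv12 hIdOfForm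
      (fun x hM α₀ hα hMa U hU hU' => (hletters x hM α₀ hα hMa U hU hU').gD2) Ta Ta₂ Tb Tb₂ hL3131 hL3131H
      (fun x hM α₀ hα hMa U hU hU' => (hlettersD x hM α₀ hα hMa U hU hU').1.dgDH) hstepL2
  -- the StepDir layer at `Rel := RelB` (multiplicity 6): LeftStep re-issued at θ_D′ ≥ θ_D, StepDirB with θ_H(β), θ_I(ε), StepL2 passed through, in (M₀′, a₀)
  obtain ⟨θD', θH, θI, M₀', hθD', hθH, hθI, hM₀', hleft', hstepC'⟩ :=
    stepDirB_layer_T3_of_lettersCZ (bg := bgT3) (P := fun _ => P) q hq H 𝔭A (fun x => (𝔡A x).Dd) (fun x => (𝔡A x).Dsd) bHXA 𝔬12 bH13 κ₀ hκ13 bHW13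
      (fun x => geoOK_geo9K x) B12₀ δ12₀ δK12 B12₃ δ12₃ t12 δT12 ρS σS θD θ2₁₂ M₀ a₀ M12 a12 Bh12 Bi12 Bq12 BhD13 Bx13 Bx0 BdX BiD BdD Bi2₁₂
      hB12₀ hB12₃ ht12 hθD hM₀ hMM haa hBh12 hBhD13 hBx13 hBx0 hBdX hBiD hσS hρST hρS₀ hρS₃ hδK0 hδKS hleft12
      (fun x hM α₀ hα hMa U hU hU' => (hG0C x hM α₀ hα hMa U hU hU').1) (fun x hM α₀ hα hMa U hU hU' => (hG0C x hM α₀ hα hMa U hU hU').2.1)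
      wZ hwZ hLH3 (fun x hM α₀ hα hMa U hU hU' => (hlettersD x hM α₀ hα hMa U hU hU').2) hX hdiv
      (fun x => RelB x) 6 (by norm_num) (fun x y' => relB_mult_real x y') (fun x a b b' h => dist_eq_of_relB_right x a b b' h)
      hvanishX hleX Ta Ta₂ Ta' Ta₂' Tb Tb₂ Tb' Tb₂' hL3131 hL3131H hR hstepL2
  have hM12' : M12 ≤ M₀' := hMM.trans hM₀'
  have hM₀pos' : 0 < M₀' := lt_of_lt_of_le hM₀ hM₀'
  -- (1) the canonical kernel family, member by member (F2)
  have hK := fun i : KIdx 2 ℓ hd3 hL 1 1 =>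
    exists_kernelFamily_structural (R := (1 : ℝ)) (H := H i) (𝔬12 i).GG (𝔬12 i).D (𝔬12 i).Dstar (𝔡A i).Dd (𝔡A i).Dsd (𝔭A i) (bHXA i) (𝔬12 i).blk (𝔬12 i).blkY (ev i) (evY i)
      (RelB i) r Cev (fun _ _ _ => 0) (fun _ _ _ => 0) (hoff i) (hoffY i) (hbd i) (hbdY i) (hwb i) (hwbY i) (hl2b i) (hl2bY i) (hloc i) (hlocle i)
      (modelSignsOn_geo9K i).supNorm_nonneg (modelSignsOn_geo9K i).l2Norm_nonneg (modelSignsOn_geo9K i).cutSup_nonneg (modelSignsOn_geo9K i).cutH_nonneg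
      (modelSignsOn_geo9K i).holder_nonneg (geoOK_geo9K i).lenpos
  choose GG _h3 _hg3 hcoR hco1R hcoG hl2N hH1N hIF _hd0 _hd1 _hd2 _hd4 hgd0 hgd1 _hgd2 hsg using hK
  -- (2) the symmetry row (F1) from the `Identities` conjunct of the DERIVED `hmodel` (face-E layer) and the letter symmetries, at (M₀′, a₀)
  have hsymGG := hsymGG_row_of_letterSymm 𝔬12 c35 a₀ M₀'
    (fun i hM α₀ hα hMa U h5 h6 => (hmodel12 i (hM₀'.trans hM) α₀ hα hMa U h5 h6).2.2.2.2)
    (fun i hM α₀ hα hMa U h5 h6 => hls i (hM12'.trans hM) α₀ hα (hMa.trans haa) U h5 h6)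
  -- (3) the (3.47) pin from the dominations and the readout row
  have hglob : ∀ (i : KIdx 2 ℓ hd3 hL 1 1) (U : (bgT3 i).Cfg) (f : Xo i U),
      ‖Gop i U f‖ ≤ max ((GG i).glob 0 U (ιo i U f) (-3)) ((GG i).glob 1 U (ιo i U f) (-3)) := by
    intro i U f
    have h0 := (hsg i U (ιo i U f)).2.1 (-3)
    have hpl : ∀ (y : (geo9K i).Site) (n : Fin 4), 0 ≤ B9.pref4 ((geo9K i).len y) n * (geo9K i).len y ^ (-3 : ℝ) := fun y n =>
      mul_nonneg (B9FromB6.pref4_nonneg ((geoOK_geo9K i).lenpos y).le n) (Real.rpow_nonneg ((geoOK_geo9K i).lenpos y).le _)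
    refine hread i U f _ (le_max_of_le_left h0.1) (fun x => (hgd0 i U (ιo i U f) (-3) x).trans ?_) (fun w => (hgd1 i U (ιo i U f) (-3) w).trans ?_)
    · rw [mul_assoc, mul_assoc]
      exact mul_le_mul_of_nonneg_right (le_max_left _ _) (hpl _ 0)
    · rw [mul_assoc, mul_assoc]
      exact mul_le_mul_of_nonneg_right (le_max_right _ _) (hpl _ 1)
  -- (4) the leaf of record, read at (M₀′, a₀) with the layers' constants and the chosen kernel family, then (BG-336)′
  exact normG_row_of_t313_classTransferS
    (t313_of_pins_T3_completePairMBZc 𝔬12 H GG bH13 𝔭A bHXA Gp bXH (fun x => (𝔡A x).Dd) (fun x => (𝔡A x).Dsd) bHW13 ev evY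
    r Cev θ12 θD' θ2₁₂ r12 B12₀ B12₂ B₄ δ12₀ δK12 σ ρ a₀ M₀' B12₃ δ12₃ ρ' α κ₀ Bh12 Bi12 Bq12 BhD13 Bx13 Bd θH θI θV Br Bi2₁₂ Bd2
    hθ12 hθD' hθH hθI hθ2₁₂ hθV hr12 hB12₀ hB12₂ hB12₃ hB₄ hBr hσ hρ' hρ'ρ hρ'ρ₅ hσρ' hρ0 hρ₃ hρδ ha₀ hM₀pos' hα0 hα1 hBi12 hBd hBi2₁₂ hBd2
    hBh12 hBq12 hBhD13 hBx13 hCev hκ13 hκW hκX hcoR hco1R hcoG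
    hsymGG hl2N hH1N hIF
    (fun x hM α₀ hα hMa U hU hU' => hmodel12 x (hM₀'.trans hM) α₀ hα hMa U hU hU')
    (fun x hM α₀ hα hMa U hU hU' => hleft' x hM α₀ hα hMa U hU hU') wZ hwZ
    (fun x hM α₀ hα hMa U hU hU' => hletters x (hM12'.trans hM) α₀ hα (hMa.trans haa) U hU hU')
    (fun x hM α₀ hα hMa U hU hU' => h152 x (hM12'.trans hM) α₀ hα (hMa.trans haa) U hU hU')
    (fun x hM α₀ hα hMa U hU hU' => hlettersD x (hM12'.trans hM) α₀ hα (hMa.trans haa) U hU hU')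
    (fun x hM α₀ hα hMa U hU hU' => ⟨(hG0C x (hM₀'.trans hM) α₀ hα hMa U hU hU').1, (hG0C x (hM₀'.trans hM) α₀ hα hMa U hU hU').2.1⟩)
    (fun x hM α₀ hα hMa U hU hU' => (hstepC' x hM α₀ hα hMa U hU hU').1)
    (fun x hM α₀ hα hMa U hU hU' => hLHH x (hM12'.trans hM) α₀ hα (hMa.trans haa) U hU hU')
    (fun x hM α₀ hα hMa U hU hU' => Letters313HZc.of_HZ (hLH3 x (hM12'.trans hM) α₀ hα (hMa.trans haa) U hU hU')
      (hWE x (hM12'.trans hM) α₀ hα (hMa.trans haa) U hU hU'))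
    (fun x hM α₀ hα hMa U hU hU' => (hG0C x (hM₀'.trans hM) α₀ hα hMa U hU hU').2.2)
    (fun x hM α₀ hα hMa U hU hU' => (hstepC' x hM α₀ hα hMa U hU hU').2) vZ hvZ
    (fun x hM α₀ hα hMa U hU hU' => hLL2 x (hM12'.trans hM) α₀ hα (hMa.trans haa) U hU hU')
    (fun x hM α₀ hα hMa U hU hU' => hLIM x (hM12'.trans hM) α₀ hα (hMa.trans haa) U hU hU')
      (fun x => HasRWExpOfOps (𝔬12 x)) (fun x => PosDefKOfOps (𝔬12 x)) (fun _ => rfl) (fun _ => rfl))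
    hCTS Gop ιo hw hglob

end Summit.QuantumFields.YangMills.Theorems.Prop7SectET3N06LeavesRecordStepLayerEvalRowsSCut

end
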